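/-
COR-CM (cell pub-hodgecm2, stage 2 of the Hodge ladder) — count-neutral KERNEL COMBINATORICS «the dihedral law», part IV: THE LAW
`μ(D(ℤ/2n), gⁿ) = β − 2 = φ₂` (seat prover-pub-hodgecm2-b23-g48-0, binder prover b23, gen 48; claim «DIHEDRAL LAW», HOME/INBOX.md l.22267).
Theorems only, on parts Ia/Ib/II/III (`Census/DihedralDatum.lean`, `…ArcPairs.lean`, `…ArcPairsHodge.lean`, `…Descent.lean`), the block count
(`Census/DihedralBlockCount.lean`: `c_mem_zpowers_g`), seat b23 gen 46ʼs
tracked descent and dihedral floor (`IndexTwoDescent.tracked_descent`, `IndexTwoDescent.card_block_sub_two_mem_lowerBounds`,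
`card_block_eq_fibreTwo_add_two_of_coset_involutions`: `Census/IndexTwoSplitResidual.lean`, `Census/IndexTwoSplitDihedralFloor.lean`) BY NAME;
no `decide`, no certificate, no named fact, no `sorry`; `Interfaces.lean` (C1), every E term, B01, `Transposition/*`, `PortJoin/*`, `D2Bridge/*`
untouched.
HONEST FRAMING: `HC_CM` is NOT proved, here or anywhere in the tree; nothing here is a period, a count of record or a headline.
T5: n/a-class (hypothesis binders = the fields of `Dihedral.Datum`; checker: self).
-/
import Summits.HodgeConjecture.CorCM.Census.DihedralArcPairsHodge
import Summits.HodgeConjecture.CorCM.Census.DihedralDescent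
import Summits.HodgeConjecture.CorCM.Census.IndexTwoSplitResidual
import Summits.HodgeConjecture.CorCM.Census.IndexTwoSplitDihedralFloor
import Summits.HodgeConjecture.CorCM.Census.DihedralBlockCount

/-!
# The dihedral law, IV: `μ(D(ℤ/2n), c = gⁿ) = β − 2 = φ₂` for every `n ≥ 1`

THE SETTING of parts Ia–III: a dihedral datum `D` for `(G, c)` — `G ⊃ ⟨g⟩` of index two, `g` of order `2n`, `c = gⁿ`, every element outside
`⟨g⟩` an involution: `G ≅ D(ℤ/2n)`, the dihedral group of order `4n` with its central rotation as complex conjugation.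

**MAIN THEOREM (`isLeast_card_gfaces_generate`, `isLeast_card_gfaces_generate_fibreTwo`).**  The least number of rank-four face relations whose
base changes generate the integer Hodge lattice of `(G, c)` modulo the pairs is EXACTLY
  **`β(G, c) − 2 = φ₂(G, c)`**
(`β = #Block c` the number of blocks, `φ₂ = fibreTwo` seat b09ʼs coinvariant fibre dimension) — seat b23 gen 46ʼs dihedral floor
`IndexTwoDescent.card_block_sub_two_mem_lowerBounds` is attained, for EVERY `n ≥ 1`: `D₈` (`22 = 24 − 2`), `D₁₂` (`202 = 204 − 2`), `D₁₆`
(`2174 = 2176 − 2`), … .  For odd `n`, `D(ℤ/2n) = D_n × C₂` is a complemented case of seat b09ʼs complete twisted law; for even `n ≥ 2`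
(`c ∈ [G, G]`, `𝒦 = G`, no cyclic character) the law is new.  The generating family is INTEGRAL (index `1`) and explicit:

* one coordinate face per block containing no arc pair (part III: the cyclic boundary descent in both coordinates), and
* one arc face `A(d,0) → A(d−1,0), A(d,−1), A(d−1,−1)` per arc-pair block `B_d`, `d ∉ {0, 1}` (§1: the descent in `d = a + b`),
* NOTHING at the two base blocks `B₀ ∪ B₁`, whose Hodge vectors are pairs (part II, the double window argument):
`β − 2` faces in all (§2: the arc-pair blocks are exactly the `2n` blocks `B_d`), generating `hodgeSpan` modulo pairs (§3), and no fewer do (§4).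

Census dictionary: for every Galois CM field whose Galois group is dihedral of order `4n` with complex conjugation the central rotation, the Hodge
ring of the whole isogeny slice is generated modulo divisor classes by the Galois conjugates of exactly `β − 2` rank-four face classes, and no
fewer Hodge generators of any kind exist modulo pairs.  Nothing here is a period.

## References
* [Pohlmann1968] H. Pohlmann, Algebraic cycles on abelian varieties of complex multiplication type, Ann. of Math. 88 (1968), Thm 1.
* [Milne1999] J. S. Milne, Lefschetz motives and the Tate conjecture, Compositio Math. 117 (1999), Prop. 2.1, p. 54.
-/

namespace Summit.HodgeConjecture.CorCM.Census.Dihedral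

open Finset
open Summit.HodgeConjecture.CorCM.Prior.AllgGroup.RfwfAllgGroup
open Summit.HodgeConjecture.CorCM.Census.BlockParity
open Summit.HodgeConjecture.CorCM.Census.Coinvariant

noncomputable section

variable {G : Type*} [Group G] [Fintype G] [DecidableEq G] {c : G} {n : ℕ} [NeZero n]
variable (D : Datum G c n) (hc2 : c * c = 1) (hc1 : c ≠ 1)

/-! ## §1 The descent of the arc pairs along `d = a + b` -/

omit [Fintype G] [DecidableEq G] in
/-- The exponent of a sum: `g^{(a+b).val} = g^{a.val} · g^{b.val}`. [folklore] -/
theorem pow_val_add (a b : ZMod (2 * n)) : D.g ^ (a + b).val = D.g ^ a.val * D.g ^ b.val := by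
  rw [← pow_add, D.pow_eq_pow_iff]; push_cast; simp only [ZMod.natCast_zmod_val]

omit [DecidableEq G] [NeZero n] in
/-- `s · (gᵏ)⁻¹ = gᵏ · s`. [folklore] -/
theorem s_mul_inv_pow (k : ℕ) : D.s * (D.g ^ k)⁻¹ = D.g ^ k * D.s := by
  rw [D.inv_pow_eq, D.s_mul_pow, ← D.inv_pow_eq, inv_inv]

/-- **The arc face of the block `B_d` translated to `A(a,b)`** (`a + b = d`): the base change along `g^{b.val}` of the arc face at `A(d, 0)` is the
arc face at `A(a, b)`. [folklore] -/
theorem mapDomain_rt_gface_arcPair (hc2 : c * c = 1) (a b : ZMod (2 * n)) :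
    Finsupp.mapDomain (rt c (D.g ^ b.val)) (gface c hc2 (arcPair D (a + b) 0) (D.g ^ (a + b).val) (D.g ^ (0 : ZMod (2 * n)).val * D.s)) =
      gface c hc2 (arcPair D a b) (D.g ^ a.val) (D.g ^ b.val * D.s) := by
  rw [mapDomain_rt_gface, ← arcPair_eq_rt, pow_val_add, mul_inv_cancel_right, ZMod.val_zero, pow_zero, one_mul, s_mul_inv_pow]

/-- `d ∉ {0, 1}` in `ℤ/2n` has `2 ≤ d.val`, and then `(d−1).val = d.val − 1`, `(d−2).val = d.val − 2`. [folklore] -/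
theorem val_sub_of_two_le {d : ZMod (2 * n)} (hd : 2 ≤ d.val) : (d - 1).val = d.val - 1 ∧ (d - 1 - 1).val = d.val - 2 := by
  have h0 : d ≠ 0 := fun h => by rw [h, ZMod.val_zero] at hd; omega
  have h1 := QuaternionColumn.val_sub_one_of_ne h0
  have h10 : d - 1 ≠ 0 := fun h => by
    have := congrArg ZMod.val h
    rw [h1, ZMod.val_zero] at this; omega
  have h2 := QuaternionColumn.val_sub_one_of_ne h10
  exact ⟨h1, by rw [h2, h1]; omega⟩

/-- **THE DESCENT ALONG `d`.**  Modulo the base changes of the arc faces at `A(d, 0)`, `2 ≤ d.val`, every vector supported on arc pairs is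
congruent to one supported on the base blocks `B₀ ∪ B₁` (`d = 0, 1`). [folklore] -/
theorem exists_descent_arcPairs (hc2 : c * c = 1) (y : CMF G c →₀ ℤ) (hy : ∀ Ψ ∈ y.support, ∃ a b : ZMod (2 * n), Ψ = arcPair D a b) :
    ∃ y' : CMF G c →₀ ℤ,
      y - y' ∈ Submodule.span ℤ (translates c (((univ : Finset (ZMod (2 * n))).filter fun d => 2 ≤ d.val).image fun d =>
        gface c hc2 (arcPair D d 0) (D.g ^ d.val) (D.g ^ (0 : ZMod (2 * n)).val * D.s))) ∧
      ∀ Ψ ∈ y'.support, ∃ a : ZMod (2 * n), Ψ = arcPair D a (-a) ∨ Ψ = arcPair D a (1 - a) := by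
  classical
  set S₂ := ((univ : Finset (ZMod (2 * n))).filter fun d => 2 ≤ d.val).image fun d =>
    gface c hc2 (arcPair D d 0) (D.g ^ d.val) (D.g ^ (0 : ZMod (2 * n)).val * D.s) with hS₂
  -- the potential `d.val` on arc pairs (and `0` elsewhere)
  set P : CMF G c → ℕ := fun Ψ => if h : ∃ ab : ZMod (2 * n) × ZMod (2 * n), Ψ = arcPair D ab.1 ab.2 then (h.choose.1 + h.choose.2).val else 0
    with hP
  have hPval : ∀ a b : ZMod (2 * n), P (arcPair D a b) = (a + b).val := by
    intro a b
    have h : ∃ ab : ZMod (2 * n) × ZMod (2 * n), arcPair D a b = arcPair D ab.1 ab.2 := ⟨(a, b), rfl⟩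
    simp only [hP, dif_pos h]
    rw [← add_eq_of_arcPair_eq D h.choose_spec]
  have hL : ∀ Ψ : CMF G c, (∃ a b : ZMod (2 * n), Ψ = arcPair D a b) →
      ¬ (∃ a : ZMod (2 * n), Ψ = arcPair D a (-a) ∨ Ψ = arcPair D a (1 - a)) →
      ∃ v ∈ Submodule.span ℤ (translates c S₂), ∃ w : CMF G c →₀ ℤ,
        (∀ Φ : CMF G c, w Φ ≠ 0 → (∃ a b : ZMod (2 * n), Φ = arcPair D a b) ∧ P Φ < P Ψ) ∧ v = Finsupp.single Ψ 1 + w := by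
    intro Ψ hK hR
    obtain ⟨a, b, rfl⟩ := hK
    set d := a + b with hd
    -- `d ∉ {0, 1}`
    have hd2 : 2 ≤ d.val := by
      by_contra hlt
      have hv : d.val = 0 ∨ d.val = 1 := by omega
      rcases hv with h0 | h1
      · apply hR; refine ⟨a, Or.inl ?_⟩
        have : b = -a := by have := (ZMod.val_eq_zero d).mp h0; rw [hd] at this; linear_combination this
        rw [this]
      · apply hR; refine ⟨a, Or.inr ?_⟩
        have hd1 : d = 1 := by
          rw [← ZMod.natCast_zmod_val d, h1, Nat.cast_one]
        have : b = 1 - a := by rw [hd] at hd1; linear_combination hd1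
        rw [this]
    obtain ⟨hv1, hv2⟩ := val_sub_of_two_le hd2
    refine ⟨gface c hc2 (arcPair D a b) (D.g ^ a.val) (D.g ^ b.val * D.s), ?_,
      Finsupp.single (arcPair D (a - 1) (b - 1)) 1 - Finsupp.single (arcPair D (a - 1) b) 1 - Finsupp.single (arcPair D a (b - 1)) 1,
      fun Φ hΦ => ?_, by rw [gface_arcPair]; abel⟩
    · -- the face is the translate of the arc face of the block `B_d`
      have hmem : Finsupp.mapDomain (rt c (D.g ^ b.val))
          (gface c hc2 (arcPair D (a + b) 0) (D.g ^ (a + b).val) (D.g ^ (0 : ZMod (2 * n)).val * D.s)) ∈ translates c S₂ :=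
        ⟨D.g ^ b.val, _, Finset.mem_image.mpr ⟨a + b, Finset.mem_filter.mpr ⟨Finset.mem_univ _, hd2⟩, rfl⟩, rfl⟩
      rw [mapDomain_rt_gface_arcPair] at hmem
      exact Submodule.subset_span hmem
    · -- the three other corners are arc pairs of smaller `d`
      have hval : ∀ Φ' : CMF G c, Φ' = arcPair D (a - 1) (b - 1) ∨ Φ' = arcPair D (a - 1) b ∨ Φ' = arcPair D a (b - 1) →
          (∃ a b : ZMod (2 * n), Φ' = arcPair D a b) ∧ P Φ' < P (arcPair D a b) := by
        rintro Φ' (rfl | rfl | rfl)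
        · refine ⟨⟨_, _, rfl⟩, ?_⟩
          rw [hPval, hPval, show a - 1 + (b - 1) = d - 1 - 1 by rw [hd]; ring, hv2, ← hd]; omega
        · refine ⟨⟨_, _, rfl⟩, ?_⟩
          rw [hPval, hPval, show a - 1 + b = d - 1 by rw [hd]; ring, hv1, ← hd]; omega
        · refine ⟨⟨_, _, rfl⟩, ?_⟩
          rw [hPval, hPval, show a + (b - 1) = d - 1 by rw [hd]; ring, hv1, ← hd]; omega
      apply hval
      by_contra hne
      push Not at hne
      apply hΦ
      rw [Finsupp.sub_apply, Finsupp.sub_apply, Finsupp.single_apply, Finsupp.single_apply, Finsupp.single_apply,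
        if_neg (Ne.symm hne.1), if_neg (Ne.symm hne.2.1), if_neg (Ne.symm hne.2.2), sub_zero, sub_zero]
  obtain ⟨y', hyy', -, hres⟩ := IndexTwoDescent.tracked_descent P
    (fun Ψ => ∃ a : ZMod (2 * n), Ψ = arcPair D a (-a) ∨ Ψ = arcPair D a (1 - a))
    (fun Ψ => ∃ a b : ZMod (2 * n), Ψ = arcPair D a b) (Submodule.span ℤ (translates c S₂)) hL y hy
  exact ⟨y', hyy', hres⟩

/-! ## §2 Counting: the arc-pair blocks are the `2n` blocks `B_d` -/

/-- **The arc-pair blocks are parametrised by `d ∈ ℤ/2n`**: `d ↦ blk A(d, 0)` is injective … [folklore] -/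
theorem blk_arcPair_injective : Function.Injective fun d : ZMod (2 * n) => blk c (arcPair D d 0) := by
  intro d d' h
  obtain ⟨Q, hQ⟩ := exists_rt_eq_of_blk_eq c h
  have e := add_eq_of_rt_eq D hQ
  simpa using e

/-- … and its image is exactly the set of blocks containing an arc pair. [folklore] -/
theorem image_blk_arcPair :
    (univ : Finset (ZMod (2 * n))).image (fun d => blk c (arcPair D d 0)) =
      univ.filter fun B : Block c => ∃ a b : ZMod (2 * n), B.out = arcPair D a b := by
  ext B
  rw [Finset.mem_image, Finset.mem_filter]
  constructor
  · rintro ⟨d, -, rfl⟩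
    refine ⟨Finset.mem_univ _, ?_⟩
    obtain ⟨Q, hQ⟩ := exists_rt_eq_of_blk_eq c
      (show blk c (arcPair D d 0) = blk c (blk c (arcPair D d 0)).out from (Quotient.out_eq _).symm)
    rw [← hQ]
    exact (exists_arcPair_rt_iff D Q _).mpr ⟨d, 0, rfl⟩
  · rintro ⟨-, a, b, h⟩
    refine ⟨a + b, Finset.mem_univ _, ?_⟩
    have e : B = blk c B.out := (Quotient.out_eq B).symm
    rw [e, h, arcPair_eq_rt D a b, blk_rt]

/-- **There are exactly `2n` arc-pair blocks.** [folklore] -/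
theorem card_arcPair_blocks :
    (univ.filter fun B : Block c => ∃ a b : ZMod (2 * n), B.out = arcPair D a b).card = 2 * n := by
  rw [← image_blk_arcPair, Finset.card_image_of_injective _ (blk_arcPair_injective D), Finset.card_univ, ZMod.card]

/-- `β = #{blocks without arc pairs} + 2n`. [folklore] -/
theorem card_block_eq :
    Fintype.card (Block c) = (univ.filter fun B : Block c => ¬ ∃ a b : ZMod (2 * n), B.out = arcPair D a b).card + 2 * n := by
  classical
  have h := card_arcPair_blocks D
  have htot := Finset.card_filter_add_card_filter_not (s := (univ : Finset (Block c)))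
    (p := fun B : Block c => ∃ a b : ZMod (2 * n), B.out = arcPair D a b)
  rw [Finset.card_univ] at htot
  omega

/-- There are at most `2n − 2` residues `d` with `2 ≤ d.val`. [folklore] -/
theorem card_filter_two_le_val : ((univ : Finset (ZMod (2 * n))).filter fun d => 2 ≤ d.val).card ≤ 2 * n - 2 := by
  classical
  have hn : 1 ≤ n := Nat.one_le_iff_ne_zero.mpr (NeZero.ne n)
  have h01 : ({0, 1} : Finset (ZMod (2 * n))) ⊆ univ.filter fun d : ZMod (2 * n) => ¬ 2 ≤ d.val := by
    intro d hd
    rw [Finset.mem_insert, Finset.mem_singleton] at hd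
    rw [Finset.mem_filter]
    refine ⟨Finset.mem_univ _, ?_⟩
    rcases hd with rfl | rfl
    · rw [ZMod.val_zero]; omega
    · rw [QuaternionColumn.val_one_eq]; omega
  have hne : (0 : ZMod (2 * n)) ≠ 1 := by
    intro h
    have := congrArg ZMod.val h
    rw [ZMod.val_zero, QuaternionColumn.val_one_eq] at this
    exact zero_ne_one this
  have h2 : 2 ≤ (univ.filter fun d : ZMod (2 * n) => ¬ 2 ≤ d.val).card :=
    le_trans (by rw [Finset.card_pair hne]) (Finset.card_le_card h01)
  have htot := Finset.card_filter_add_card_filter_not (s := (univ : Finset (ZMod (2 * n)))) (p := fun d : ZMod (2 * n) => 2 ≤ d.val)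
  rw [Finset.card_univ, ZMod.card] at htot
  omega

/-! ## §3 Generation by `β − 2` faces -/

include D in
/-- **GENERATION.**  There is a family of at most `β − 2` face relations whose base changes, together with the pairs, generate the integer
Hodge lattice of the dihedral datum — integrally. [folklore] -/
theorem exists_gfaces_generate :
    ∃ S : Finset (CMF G c →₀ ℤ), (↑S ⊆ gfaceSet G c hc2) ∧ S.card ≤ Fintype.card (Block c) - 2 ∧
      hodgeSpan c hc2 ≤ Submodule.span ℤ (pairSet c) ⊔ Submodule.span ℤ (translates c S) := by
  classical
  obtain ⟨S₁, hS₁F, hS₁card, hS₁⟩ := exists_faces_descent_to_arcPairs D hc2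
  set S₂ := ((univ : Finset (ZMod (2 * n))).filter fun d => 2 ≤ d.val).image fun d =>
    gface c hc2 (arcPair D d 0) (D.g ^ d.val) (D.g ^ (0 : ZMod (2 * n)).val * D.s) with hS₂
  have hS₂F : (↑S₂ : Set (CMF G c →₀ ℤ)) ⊆ gfaceSet G c hc2 := by
    intro f hf
    obtain ⟨d, -, rfl⟩ := Finset.mem_image.mp (Finset.mem_coe.mp hf)
    exact gface_arcPair_mem_gfaceSet D hc2 d 0
  refine ⟨S₁ ∪ S₂, ?_, ?_, fun y hy => ?_⟩
  · rw [Finset.coe_union]; exact Set.union_subset hS₁F hS₂F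
  · have h := Finset.card_union_le S₁ S₂
    have h2 : S₂.card ≤ 2 * n - 2 := le_trans Finset.card_image_le (card_filter_two_le_val (n := n))
    have hβ := card_block_eq D
    have hn : 1 ≤ n := Nat.one_le_iff_ne_zero.mpr (NeZero.ne n)
    omega
  · -- descend `y` to the arc pairs, then to `B₀ ∪ B₁`, where it is a sum of pairs
    obtain ⟨y₁, h₁, hy₁⟩ := hS₁ y
    obtain ⟨y₂, h₂, hy₂⟩ := exists_descent_arcPairs D hc2 y₁ hy₁
    have hsub : ∀ T : Finset (CMF G c →₀ ℤ), T ⊆ S₁ ∪ S₂ → translates c T ⊆ translates c (S₁ ∪ S₂) := by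
      rintro T hT _ ⟨Q, f, hf, rfl⟩
      exact ⟨Q, f, hT hf, rfl⟩
    have h₁' : y - y₁ ∈ Submodule.span ℤ (translates c (S₁ ∪ S₂)) :=
      Submodule.span_mono (hsub S₁ Finset.subset_union_left) h₁
    have h₂' : y₁ - y₂ ∈ Submodule.span ℤ (translates c (S₁ ∪ S₂)) :=
      Submodule.span_mono (hsub S₂ Finset.subset_union_right) h₂
    have hF : (↑(S₁ ∪ S₂) : Set (CMF G c →₀ ℤ)) ⊆ gfaceSet G c hc2 := by
      rw [Finset.coe_union]; exact Set.union_subset hS₁F hS₂F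
    have hy₂H : y₂ ∈ hodgeSpan c hc2 := by
      have e : y₂ = y - ((y - y₁) + (y₁ - y₂)) := by abel
      rw [e]
      exact Submodule.sub_mem _ hy (IndexTwoDescent.span_translates_le_hodgeSpan hc2 _ hF (Submodule.add_mem _ h₁' h₂'))
    have hy₂P : y₂ ∈ Submodule.span ℤ (pairSet c) := mem_span_pairSet_of_mem_hodgeSpan D hc2 hy₂H hy₂
    have e : y = ((y - y₁) + (y₁ - y₂)) + y₂ := by abel
    rw [e]
    exact Submodule.add_mem _ (Submodule.mem_sup_right (Submodule.add_mem _ h₁' h₂')) (Submodule.mem_sup_left hy₂P)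

/-! ## §4 The law -/

omit [NeZero n] in
include D hc1 in
/-- **THE FLOOR** (seat b23 gen 46, BY NAME): every generating family of faces of a dihedral datum has at least `β − 2` members. [folklore] -/
theorem card_block_sub_two_mem_lowerBounds :
    Fintype.card (Block c) - 2 ∈ lowerBounds {m : ℕ | ∃ S : Finset (CMF G c →₀ ℤ), ↑S ⊆ gfaceSet G c hc2 ∧ S.card = m ∧
      hodgeSpan c hc2 ≤ Submodule.span ℤ (pairSet c) ⊔ Submodule.span ℤ (translates c S)} :=
  IndexTwoDescent.card_block_sub_two_mem_lowerBounds (c_mem_zpowers_g D) hc2 hc1 D.hcen D.hindex D.hs D.hinvol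

include D hc1 in
/-- **THE DIHEDRAL LAW `μ(D(ℤ/2n), gⁿ) = β − 2`.**  For every dihedral datum the least number of rank-four face relations whose base changes
generate the integer Hodge lattice modulo the pairs is EXACTLY the number of blocks minus two. [folklore] -/
theorem isLeast_card_gfaces_generate :
    IsLeast {m : ℕ | ∃ S : Finset (CMF G c →₀ ℤ), ↑S ⊆ gfaceSet G c hc2 ∧ S.card = m ∧
      hodgeSpan c hc2 ≤ Submodule.span ℤ (pairSet c) ⊔ Submodule.span ℤ (translates c S)} (Fintype.card (Block c) - 2) := by
  refine ⟨?_, card_block_sub_two_mem_lowerBounds D hc2 hc1⟩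
  obtain ⟨S, hSF, hcard, hgen⟩ := exists_gfaces_generate D hc2
  have hge := card_block_sub_two_mem_lowerBounds D hc2 hc1 ⟨S, hSF, rfl, hgen⟩
  exact ⟨S, hSF, le_antisymm hcard hge, hgen⟩

include D hc1 in
/-- **In the coinvariant currency: `μ(D(ℤ/2n), gⁿ) = φ₂(G, c)`**, and `φ₂ + 2 = β` (seat b23 gen 46ʼs
`card_block_eq_fibreTwo_add_two_of_coset_involutions`). [folklore] -/
theorem isLeast_card_gfaces_generate_fibreTwo :
    IsLeast {m : ℕ | ∃ S : Finset (CMF G c →₀ ℤ), ↑S ⊆ gfaceSet G c hc2 ∧ S.card = m ∧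
      hodgeSpan c hc2 ≤ Submodule.span ℤ (pairSet c) ⊔ Submodule.span ℤ (translates c S)} (fibreTwo c hc2) := by
  have h := IndexTwoDescent.card_block_eq_fibreTwo_add_two_of_coset_involutions (c_mem_zpowers_g D) hc2 hc1 D.hcen D.hindex
    D.hs D.hinvol
  have e : fibreTwo c hc2 = Fintype.card (Block c) - 2 := by omega
  rw [e]
  exact isLeast_card_gfaces_generate D hc2 hc1

omit [NeZero n] in
include D hc1 in
/-- **`β = φ₂ + 2`** for a dihedral datum (restated BY NAME for the census dictionary). [folklore] -/
theorem card_block_eq_fibreTwo_add_two : Fintype.card (Block c) = fibreTwo c hc2 + 2 :=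
  IndexTwoDescent.card_block_eq_fibreTwo_add_two_of_coset_involutions (c_mem_zpowers_g D) hc2 hc1 D.hcen D.hindex D.hs D.hinvol

end

end Summit.HodgeConjecture.CorCM.Census.Dihedral
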